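import Mathlib
import HarnessLib
import HarnessLib.Audit
import Summits.SmoothPoincare4.Statement
import Literature.Geometry.Riemannian.CurvatureOperator
import Literature.Topology.FourManifolds.SphereSimplyConnected
import HarnessLib.Audit.Status.Attr

/-!
Route: AngleDefectCertificates

DORMANT since 2026-08-23T00:30:40Z (reconciler: no traction for 5.8 d (last activity item-evidence-added at 2026-08-17T04:56:18Z); parked, not closed — `ledger route dormant route-SmoothPoincare4-AngleDefectCertificates --off` to reacti) — unstaffed, not closed; items shared with open routes are served there. `ledger route dormant <id> --off` reactivates.

# Route AngleDefectCertificates — angle-defect certificates — a smooth-compatible spherical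
polyhedral metric with no angle excess forces S⁴ (smoothing to positive curvature operator, then
Hamilton)

It suffices to show X = REC_sc ∧ EX (card angle-defect-volume-certificates, re-centred as its
novelty audit recommends; rev 4 re-routes the
deciding chain around every unproved Literature fact). An ANGLE-DEFECT
CERTIFICATE for a smooth 4-manifold M is finite data: a finite simplicial complex K ⊂ ℝᴺ with a
homeomorphism |K| → M that is a C^∞
immersion on every closed simplex (a Whitehead smooth triangulation of THIS smooth structure), and
cosines c(a,b) of spherical edge lengths
making every 4-simplex a non-degenerate spherical simplex (5×5 Gram matrix positive definite) with
NO ANGLE EXCESS: around every triangle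
the spherical dihedral angles (read off the inverse Gram matrices) sum to ≤ 2π — i.e. |K| with the
glued piecewise-spherical metric is an
Alexandrov space of curvature ≥ 1 (BuragoGromovPerelman1992). EX (target CertifiedSpheresExist,
stated over the Statement's own
quantifier shape): every Hausdorff second-countable smooth 4-manifold homotopy equivalent to S⁴ has
a certificate. REC_sc (crux
PolyhedralSphereRecognition, recognition form): a SIMPLY CONNECTED smooth 4-manifold with a
certificate (it is then closed) is
diffeomorphic to S⁴. Its intended proof is the line's whole smooth half: certificate ⇒ C^∞ metric of
positive curvature operator on the
same structure (support PolyhedralPCORecognition = REC = the 4-dimensional, PL, spherical case of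
Petrunin's Smoothing Conjecture,
arXiv:1411.0307 Conj. 2: in dimension 4 "nonnegative cosectional curvature has the same meaning as
nonnegative curvature operator")
⇒ Hamilton1986 Thm 1.1 (normalised Ricci flow to constant curvature, then Killing–Hopf; Literature
debt
`hamilton_positiveCurvatureOperator_classification_four`, reduced in tree to H1 + H2 with the
topological tail proved) ⇒ S⁴ for π₁ = 1.
The simply-connected scoping follows the route review: a certified closed 4-manifold is a homotopy
S⁴ or a homotopy ℝP⁴ (Cheeger1986
Thm 3(ii) + Myers + Freedman), and only the first conjunct is on the path to the Statement. The
card's volume threshold / Grove–Shiohama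
branch is kept only as a fallback restatement (§ Two-layer plan); its Schläfli volume ascent
survives as the search ENGINE for EX.
Lean: `PolyhedralSphereRecognition ∧ CertifiedSpheresExist`

## Assembly
Pure logic plus π₁(S⁴) = 1 (rev 4): for M ≃ₕ S⁴ (Hausdorff, second countable, C^∞ on ℝ⁴) EX gives a
certificate on M; M is simply
connected (`simplyConnectedSpace_sphere_four_holds`, proved, transported along the homotopy
equivalence by Mathlib's
`ContinuousMap.HomotopyEquiv.simplyConnectedSpace`); REC_sc returns M ≃ₘ S⁴, i.e. SmoothPoincare4.
The deciding theorem `closes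
(hRec : PolyhedralSphereRecognition) (hEx : CertifiedSpheresExist) : SmoothPoincare4` is four lines
with axioms {propext,
Classical.choice, Quot.sound}; no Literature fact, proved or unproved, is a hypothesis, and the
route imports only
CurvatureOperator (PCO vocabulary of the two PCO items) and SphereSimplyConnected.

Rationale: WHY THIS LINE. Every curvature route on this summit (PIC, WeylBudget, RicciFat, EntropyRung; cards
ricci-fat, curvature-certificates-numerical-ricci-flow) must
produce a smooth metric ON THE UNKNOWN MANIFOLD; here the curvature hypothesis is a FINITE,
kernel-checkable inequality system on a triangulation
(interval arithmetic on Gram matrices and arccos), searchable on explicit triangulations of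
presentation spheres (TsurugaLutz2013,
arXiv:1302.6856: the Akbulut–Kirby sphere triangulated) — comparison geometry as a certificate
format, with all analysis moved into
ONE universal statement, REC (PCO form: support PolyhedralPCORecognition; recognition form on the
deciding chain: crux
PolyhedralSphereRecognition = REC_sc). Imported: Alexandrov / polyhedral metric geometry
(BuragoGromovPerelman1992, AlexanderKapovitchPetrunin2024,
Petrunin2003), and Ricci-flow smoothing (Lebedeva–Matveev–Petrunin–Shevchishin arXiv:1411.0307 =
ShevchishinEtAl2015 in dim 3, whose
stated obstacle in higher dimension — Question 4 there, a uniform Ricci-flow existence time under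
curvature operator ≥ κ, diam ≤ D,
vol ≥ v — is now Theorem 1 / Cor. 3–4 of Bamler–Cabezas-Rivas–Wilking arXiv:1707.03002; cone tips:
GianniotisSchulze2018
arXiv:1610.09753 Thm 1.1 with Deruelle2016 expanders; codimension-2 edges: Lavoyer2026
arXiv:2305.00344), closed off by Hamilton1986
Thm 1.1 (PCO ⇒ S⁴/ℝP⁴). What is new relative to
LMPS is located precisely: in dim 3 every vertex link is a convex surface of S³ by Alexandrov's
embedding theorem (arXiv:1411.0307
Cor. 6), so stars are convex-cone hypersurfaces; in dim 4 vertex links are arbitrary CBB(1)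
polyhedral 3-spheres and need not bound a
convex spherical polytope — crux PolytopalPCORecognition isolates the LMPS+BCRW-accessible case,
PolyhedralPCORecognition is the
general one. Spherical (not Euclidean) simplices are deliberate: Kühnel's 9-vertex ℂP²₉ is already a
NON-NEGATIVELY curved Euclidean polyhedral ℂP²
(Panov2009 p.3, arXiv:0901.1840, a finite isometric quotient of a flat complex torus; its holonomy
preserves a symplectic form by
Cheeger's vanishing theorem), so a Euclidean certificate can force at most Rm ≥ 0, whereas CBB(1)
forces b₂ = 0 (support
CertificateKillsSecondHomology = Cheeger1986 Thm 3(ii), the line's checkable prediction, confirmed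
numerically on ℂP²₉ / S²×S²₁₁ by the
refuters) and should force Rm > 0. Negatives index: empty; no prior route is polyhedral.

RANKED CRUXES. #0 CertifiedSpheresExist (target; rev 4 restated over the Statement's quantifier
shape, same content) — every Hausdorff second-countable smooth
4-manifold M ≃ₕ S⁴ admits an angle-defect certificate: a finite simplicial complex K ⊂ ℝᴺ, pure of
dimension 4, a homeomorphism |K| ≃ₜ M that is a smooth
immersion on each closed simplex, and a symmetric unit-diagonal cosine function c with every 4-face
Gram matrix positive definite and every triangle's
spherical dihedral-angle sum ≤ 2π (card items VOL/certificate, without the volume threshold). (why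
it might fail: ⇔ SPC4 given REC_sc; constructively,
admissible spherical lengths may exist on NO triangulation the engine reaches from a
presentation-sphere triangulation (dihedral-angle sums of a
4-simplex are bounded below, so high triangle valence obstructs), so nothing new is ever certified.)
[TsurugaLutz2013, arXiv:1302.6856,
BuragoGromovPerelman1992, AlexanderKapovitchPetrunin2024, Whitehead1940]
#2 PolyhedralSphereRecognition (crux; rev 4, the deciding-chain form of REC) — REC_sc — a Hausdorff
second-countable SIMPLY CONNECTED smooth 4-manifold
carrying an angle-defect certificate for its own smooth structure (hence closed) is diffeomorphic to
S⁴. = PolyhedralPCORecognition restricted to π₁ = 1,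
followed by Hamilton 1986 Thm 1.1 and Killing–Hopf — Petrunin's Smoothing Conjecture (dim 4, PL, κ =
1, same smooth structure) in RECOGNITION form, as
RicciFat.VolumeSphereRecognition and EntropyRung.SubcylindricalRecognition are stated; a genuinely
route-owned open statement (it does not contain
Hamilton's theorem: PCO metrics are not known to admit CBB(1) polyhedral approximations), resting on
no Literature fact. [difficulty: open-problem]
(why it might fail: folds Petrunin's dim-4 smoothing conjecture AND Hamilton 1986 into one claim:
ONE certificate on a simply connected closed
4-manifold ≠ S⁴ kills it — ℂP², S²×S² (b₂ ≠ 0; ℂP²₉/S²×S²₁₁ searches empty, fruitless by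
Cheeger1986) or a certified exotic homotopy sphere; no convex
model at dim-4 vertices.) [ShevchishinEtAl2015, arXiv:1411.0307, Petrunin2003,
BamlerCabezasrivasWilking2019, arXiv:1707.03002, Hamilton1986, LeeRiemannianManifolds2018,
Cheeger1986]
#3 PolytopalPCORecognition (crux) — REC restricted to LINK-POLYTOPAL certificates: additionally, for
every vertex v the link of v (neighbours a of v,
spherical edge lengths = the angles at v, cosines by the spherical law of cosines) is realised
simplexwise-isometrically by unit vectors q(a) ∈ S⁴ ⊂
ℝ⁵ such that every link tetrahedron spans a supporting hyperplane of all q(a) and distinct link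
tetrahedra have disjoint open hulls — the link bounds a
convex spherical 4-polytope, so every vertex star is a convex hypersurface germ of S⁵ (curvature
operator ≥ 1), exactly the local picture of the
3-dimensional LMPS proof. Conclusion: a C^∞ metric of positive curvature operator (PCO form; the
realistic first target, a special case of the support
item PolyhedralPCORecognition, glue 7225 ⊂ 7224 proved by refuter g41-12). [difficulty: XL] (why it
might fail: gluing the local convex smoothings at
vertices/edges/triangles into metrics with curvature operator ≥ −ε, uniformly non-collapsed, is
unproved beyond dim 3; BCRW Cor. 3 then yields Rm ≥ 0
only, and Rm > 0 needs Hamilton's strong maximum principle to exclude Kähler/product/flat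
alternatives.) [ShevchishinEtAl2015, arXiv:1411.0307,
BamlerCabezasrivasWilking2019, arXiv:1707.03002, Deruelle2016, GianniotisSchulze2018,
arXiv:1610.09753, Hamilton1986]
#4 CertificateKillsSecondHomology (support since rev 3: KNOWN = Cheeger1986 LNM 1201 Thm 3(ii)) —
polyhedral Bochner — a closed SIMPLY CONNECTED smooth
4-manifold with an angle-defect certificate has H₂(M; ℤ) = 0 (so ℂP², S²×S², #ₙℂP² carry no
smooth-compatible CBB(1) polyhedral metric); the line's
falsifiable prediction, confirmed by the executed certificate searches. [difficulty: L]
[Cheeger1986, doi:10.1007/bfb0075646, Cheeger1983,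
KuhnelBanchoff1983, Panov2009]
#9 PolyhedralPCORecognition (support since rev 4; crux #2 of revs 0–3) — REC, PCO form — a Hausdorff
second-countable smooth 4-manifold carrying an
angle-defect certificate (then closed) admits a C^∞ Riemannian metric with positive curvature
operator: Petrunin's Smoothing Conjecture in dimension 4
for PL manifolds, spherical (κ = 1) case, smoothing on the SAME smooth structure. The analytic core
of the line and the foreseen split child of
PolyhedralSphereRecognition (§ Two-layer plan); kept general in π₁ (smoothing is local; its ℝP⁴
conjunct is the ProjectiveRigidity prediction).
Grounded open-in-print (g15-12), refuter-checked, ℂP²₉ evidence attached. [difficulty: open-problem]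
[ShevchishinEtAl2015, arXiv:1411.0307, Petrunin2003,
BamlerCabezasrivasWilking2019, arXiv:1707.03002, GianniotisSchulze2018, Lavoyer2026, Hamilton1986,
Panov2009]
#9 RoundSphereCertificate (support) — calibration and non-vacuity — the standard S⁴ ⊂ ℝ⁵ (Mathlib's
smooth structure) admits an angle-defect
certificate: radially project the boundary of the regular 5-simplex inscribed in S⁴ (6 vertices, c ≡
−1/5, dihedral angles 2π/3, three 4-simplices
around each triangle, cone angles exactly 2π), or any smaller copy c ≡ cos((1−s)·arccos(−1/5)); the
smooth-immersion clause is the smoothness of central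
projection on each affine simplex. Arithmetic verified exactly by refuters g40/g41 (G = (6/5)I −
(1/5)J ≻ 0, G⁻¹ = (5/6)(I+J), 3·arccos(−1/2) = 2π).
[difficulty: M, provable-now] [Whitehead1940, Munkres1966, KuhnelBanchoff1983]
Dropped at rev 4: HamiltonPcoClassification (support of revs 1–3 = the Literature fact
`hamilton_positiveCurvatureOperator_classification_four` by name):
no longer a hypothesis of `closes`; it survives as the recorded needs-fact of § Not decomposed yet.

TWO-LAYER PLAN. Foreseen glued splits (nothing filed now; k ≤ 3, depth 1).
PolyhedralSphereRecognition ⇐ PolyhedralPCORecognition (π₁ = 1 suffices) →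
PcoSphereRecognition (a closed simply connected 4-manifold with a C^∞ metric of positive curvature
operator is diffeomorphic to S⁴: Hamilton1986 Thm 1.1,
in tree `hamilton_positiveCurvatureOperator_sphere_four_of_classification` from the named fact,
itself reduced to H1 Ricci-flow convergence + H2
Killing–Hopf in HamiltonPCOClassificationProofs.lean — to be filed BY NAME when the smoothing child
has a skeleton, flipping the route to
stock-pending-debt on exactly that fact, D-0027 §3.3) → PolyhedralSphereRecognition.
PolyhedralPCORecognition ⇐ PolytopalPCORecognition →
PolytopalReduction (every certified M has a link-polytopal certificate on the same PL structure:
subdivide/re-metrise stars) → PolyhedralPCORecognition.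
Or PolyhedralPCORecognition ⇐ LinkSmoothing (a CBB(1) polyhedral 3-sphere is a Lipschitz limit of
metrics with sec ≥ 1 on S³: LMPS with κ = 1) →
ConeDesingularisation (spherical cones over such links, edges à la Lavoyer2026, tips à la
GianniotisSchulze2018/Deruelle2016, keeping curvature operator
≥ −ε and volume ≥ v) → BCRWUpgrade (arXiv:1707.03002 Cor. 3–4, in tree as the named fact
BamlerCabezasRivasWilking2019_cor3_nonnegativeCurvatureOperator,
+ Hamilton's strong maximum principle: Rm ≥ −ε(v, D) non-collapsed on a certified M ⇒ Rm > 0) →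
PolyhedralPCORecognition.
EX ⇐ test families by the engine (presentation spheres Σ_AK(n) via TsurugaLutz2013 triangulations;
Gluck twists) — informative either way.
FALLBACK if only sectional control is provable: restate REC as SMOOTH₄-sec (∀ε: metrics with sec ≥
1−ε and volume ≥ V_poly − ε) and
EX as EX½ (certificate with Σ vol(σ) > 4π²/3), assembled through Bishop–Gromov + Grove–Shiohama
(diam > π/2 ⇒ twisted sphere) +
cerf_twistedSphere_four — the card's original spine (two more named facts, spherical 4-simplex
volumes by certified quadrature).

KILL CRITERIA. A smooth-compatible CBB(1) polyhedral metric on a simply connected closed 4-manifold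
other than S⁴ (ℂP², S²×S², a certified exotic
homotopy sphere) refutes PolyhedralSphereRecognition and, unless the witness is an exotic sphere,
PolyhedralPCORecognition with it: if its links are
polytopal, PolytopalPCORecognition dies too — close `refuted:PolyhedralSphereRecognition`; if not,
pivot (`--restate`) to the polytopal spine (target :=
link-polytopal certificates exist, crux := polytopal REC_sc). A certificate on a
Cappell–Shaneson/Fintushel–Stern fake ℝP⁴ refutes the support item
PolyhedralPCORecognition (no PCO metric there) but NOT the deciding chain; it would be recorded as
the ProjectiveRigidity prediction failing and the
support item dropped. Admissible lengths found on ℂP²₉ / a triangulated S²×S² refute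
CertificateKillsSecondHomology AND both REC items by the same
witness (searches executed 2026-08-15: none). A refutation of CertifiedSpheresExist exhibits a
homotopy 4-sphere with no certificate while S⁴ has one
(RoundSphereCertificate; certificates transport along diffeomorphisms) — an exotic S⁴,
¬SmoothPoincare4: the route closes with the
problem. A published counterexample to Petrunin's Smoothing Conjecture for 4-dimensional polyhedral
MANIFOLDS closes the route
`exhausted` unless it is Euclidean-only. SmoothPoincare4 proved elsewhere moots everything (round
metric, RoundSphereCertificate).

NOT DECOMPOSED YET. The smooth recognition step is deliberately folded into
PolyhedralSphereRecognition at rev 4 (cone repair): needs-fact: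
Literature.Geometry.Riemannian.hamilton_positiveCurvatureOperator_classification_four (Hamilton 1986
Thm 1.1; XL Literature debt = H1 normalised Ricci
flow to constant curvature + H2 Killing–Hopf, tail proved in HamiltonPCOClassificationProofs.lean) —
the END-GAME tool a prover of the crux will want
once a certificate has been smoothed to Rm > 0; it re-enters BY NAME only with the split of §
Two-layer plan. The link-smoothing lemma (LMPS in dim 3
with κ = 1, strict bound), the codimension-2 smoothing lemma (doubly-warped surgery along open
triangles: provable, curvature operator diagonal), the non-collapsing/diameter bookkeeping for BCRW,
and the strong-maximum-principle
upgrade Rm ≥ 0 ⇒ Rm > 0 on certified M — all layer-2 material under PolyhedralPCORecognition. The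
Euclidean CBB(0) variant (needs Hamilton's NON-negative
curvature-operator classification `hamilton1986_nonnegCurvatureOperator_four` and BCRW, both
unproved named facts). The engine itself: certified checker
(Gram → dihedral → defects, interval arithmetic) + Schläfli-driven volume ascent / feasibility
search in log-edge-lengths with bistellar moves — kit jobs,
no items. Literature definitions replacing the inline clauses (§ Definition requests;
`SphericalPolyhedralData.IsCBBOne` now exists in tree). No PL
Grove–Shiohama (card crux PLGS) item: it belongs to the fallback spine. PolyhedralPCORecognition /
PolytopalPCORecognition keep general π₁ on purpose
(the route review's [SimplyConnectedSpace M] narrowing is realised by the chain crux instead).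

CHEAPEST FALSIFIER. Feasibility search for CBB(1) spherical edge lengths (all 5×5 Grams PD, all
triangle cone angles ≤ 2π) on Kühnel–Banchoff's 9-vertex
ℂP²₉ (f = (9, 36, 84, 90, 36); 360 triangle–facet incidences over 84 triangles, mean valence 4.29
vs. 3 for ∂Δ⁵) and on Lutz's S²×S²₁₁: ONE success kills
both REC items and CertificateKillsSecondHomology (ℂP² has no metric with Rm > 0: b₂ ≠ 0). EXECUTED
2026-08-15 by refuter g41-43 (evidence
cp2cert/REPORT.md on stmt-SmoothPoincare4-7226): annealed L-BFGS over the 36 edge lengths, min over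
restarts of max_t cone(t) = 2.0022π free-scale
(edges collapse to the flat limit where the 63 valence-4/5/6 triangles are tight at 2π and spherical
excess is strictly positive; fixed-scale excess ≈
0.19·L₀² rad: 2.1635π@1.2, 2.0441π@0.8, 2.0147π@0.5, 2.0057π@0.3); S²×S²₁₁ best 2.536π — NO
certificate, as Cheeger1986 Thm 3(ii) predicts (a certified
closed 4-manifold is a real homology sphere). The falsifier therefore does not fire on b₂ ≠ 0 test
manifolds at all; the next cheapest is a certificate
search on triangulated CANDIDATE exotic spheres / Gluck twists (TsurugaLutz2013's Akbulut–Kirby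
sphere), which can only confirm, and on quotients: an
antipodally symmetric certificate search on triangulated fake ℝP⁴ double covers (kills the support
item only).

NUMBERS. Regular Euclidean 4-simplex: dihedral angle arccos(1/4) ≈ 75.52°; ∂Δ⁵ has 3 facets per
triangle ⇒ cone angle ≈ 226.6° < 360° (strict
certificate after shrinking). Equality case: 6 vertices of the regular 5-simplex on S⁴, c = −1/5,
inverse-Gram ratio 1/2, dihedral
angle 2π/3, cone angle exactly 2π, total volume vol(S⁴) = 8π²/3 (fallback threshold 4π²/3). Dihedral
formula used in the Lean text:
cos θ_{ij}(σ) = −(G_σ⁻¹)_{ij}/√((G_σ⁻¹)_{ii}(G_σ⁻¹)_{jj}) (checked on both cases above). Link edge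
cosine at v:
(c(a,b) − c(v,a)c(v,b))/√((1−c(v,a)²)(1−c(v,b)²)). BCRW: ε(4, v₀, D) of arXiv:1707.03002 Cor. 3
(inexplicit). ℂP²₉: f-vector
(9,36,84,90,36), triangle valences {3:21, 4:27, 5:27, 6:9}. Items: 6 at open; rev 4–6: 7 (1 target,
2 cruxes, 3 support, 1 assembly). Cone (rev 4):
imports 4 → 2 modules (CurvatureOperator, SphereSimplyConnected); unproved named facts in the import
closure 27 → 13, all 13 being the SPC4Wave0
siblings imported by the sub-problem Statement itself; unproved facts in the used-constants cone 1 →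
0; `closes` axioms {propext, Classical.choice,
Quot.sound} (Sketch.lean rc 0, 8 s).
Cone (rev 6, repair g2, 2026-08-15): the route text now references NO declaration of SPC4Wave0
(CertificateKillsSecondHomology restated over
Mathlib's singularHomologyFunctor — the definitional unfolding of `singularHomologyZ`, `Iff.rfl`
with stmt-SmoothPoincare4-7226); used-constants cone
0 unproved / 22; the 13 unproved facts of the IMPORT closure (SmoothSchoenfliesConjectureFour,
ExistsExoticFourSphere, NoExoticSphereTwoProdConjecture,
nonempty_homeomorph_sphere_four, … — all of Literature.Topology.FourManifolds.SPC4Wave0) enter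
SOLELY through the auto-import
`Summits.SmoothPoincare4.Statement` → operator-owned
`Summits/SmoothPoincare4/SmoothPoincare4/Statement.lean` line 2 `import
Literature.Topology.FourManifolds.SPC4Wave0`, which the Statement does not use (deleting that line
elaborates: rc 0, axioms unchanged) and which puts
the same 13 into the cone of 46 of the 48 SPC4 route files. needs-fact: NONE of the 13 (two are open
conjectures and one is ¬SPC4, so no import-cone
threshold can ever clear while that import stands). OPERATOR ACTION REQUESTED: delete that import
(routes QuotientSpheres, SymplecticOrigami
[singularHomologyZ], CartanHadamardSwindle, EuclideanOrigami [sphereFourEquator], SchoenfliesSplit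
[SmoothSchoenfliesConjectureFour] then need
`Literature.Topology.FourManifolds.SPC4Wave0` among their declared imports, or the two sorry-free
glue defs move to a facts-free module), or score
route cones by used constants as the gate's `staffable` already does. Nothing further can be
re-routed inside this route.

DEFINITION REQUESTS. (D1) `Literature.Topology.FourManifolds.IsSmoothTriangulation K h` — finite
Euclidean simplicial complex + homeomorphism |K| ≃ₜ M that
is a C^∞ immersion on each closed simplex (Whitehead1940; Munkres1966 Def. 8.3), to replace the
inline clause; with the lemma that it is
a combinatorial manifold and induces a Whitehead-compatible PL atlas (`IsWhiteheadCompatible`). (D2)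
`Literature.Geometry.Polyhedral.
SphericalData` (cosine function, Gram matrices, `dihedralAngle`, `coneAngle` at codimension-2 faces,
`IsCBBOne`) with the named fact
"cone angles ≤ 2π ⇔ CBB(1)" (BuragoGromovPerelman1992; AlexanderKapovitchPetrunin2024, ch.
Polyhedral spaces). (D3)
`IsPolytopalLink`. Cite facts wanted (kind cite): BCRW arXiv:1707.03002 Thm 1 / Cor. 3 (in tree);
LMPS arXiv:1411.0307 Thm 1 and Conj. 2
(statement); Petrunin2003 Thm (Lipschitz limits of polyhedral CBB have cosectional ≥ 0);
GianniotisSchulze2018 Thm 1.1; Hamilton 1986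
non-negative curvature-operator classification (for the Euclidean variant; in tree, unproved).

Novelty: Searches (2026-08-15): `lit citing arxiv:1411.0307` (10 citing works: arXiv:2305.00344, 2503.05896,
1610.09753, 2111.02301 … — none
smooths 4-dimensional polyhedral manifolds); `lit search --source zbmath` × 13 queries ("polyhedral
spaces nonnegative curvature
smoothing" 2; "Petrunin polyhedral approximations" 1; "polyhedral metric curvature bounded below
four-manifold" 0; "polyhedral metrics
positive curvature manifold Alexandrov cone" 1 (Berestovskii 2019 survey); "polyhedral Kähler
manifolds Panov" 4; "constructing
complicated spheres" 1; "Ricci flow edge type conical singularities" 1; "Regge calculus four-sphere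
positive curvature" 0; …);
`lit galaxy search --star all` "nonnegative cosectional curvature" / "smoothing polyhedral" /
"polyhedral metric of nonnegative
curvature" (0 relevant); `lit vsearch` (held: Grove–Petersen Comparison Geometry pp.168-172, Kühnel
tight triangulations); READ:
arXiv:1411.0307 pp.1-6, arXiv:1610.09753 pp.1-4, arXiv:1707.03002 p.3; local hybrid index DOWN and
arXiv/OpenAlex/S2 HTTP 429 this
session (to be re-run by the auditor: "smoothing polyhedral 4-manifolds curvature operator", "PL
manifolds admitting polyhedral metrics
of positive curvature"); plus the card's and its auditor's searches (Grove–Shiohama, LMPS, Petrunin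
2003 read).
Nearest prior art found: ShevchishinEtAl2015 = arXiv:1411.0307 (dim-3 smoothing; Smoothing
Conjecture stated for all dimensions, dim 4 =
curvature operator); Petrunin2003 (necessity: polyhedral CBB limits are cose  [refs: 1411.0307, 2305.00344, 1610.09753, 1707.03002, arxiv:1411.0307, ShevchishinEtAl2015, Petrunin2003, BamlerCabezasrivasWilking2019, Panov2009]

Barriers (technique_class: polyhedral-curvature-certificate, alexandrov-smoothing): - technique_class: polyhedral-curvature-certificate, alexandrov-smoothing
- Literature.Barriers.SmoothPoincare4.TopologicalBarrierFour: evaded by construction — the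
certificate is attached to the SMOOTH structure (C^∞ immersion on each simplex); with a merely
topological triangulation REC would contain SPC4 (S⁴_top = |∂Δ⁵| is certified) and EX would be
Freedman's theorem. The diffeomorphism comes from Ricci-flow convergence (Hamilton1986), not from an
invariant.
- Literature.Barriers.SmoothPoincare4.ProjectiveRigidityBarrierFour: REC is natural under finite
covers (certificates lift), exactly like Hamilton's theorem; hence it PREDICTS that the
Cappell–Shaneson / Fintushel–Stern fake ℝP⁴'s carry no smooth-compatible CBB(1) polyhedral metric
(equivalently: the exotic free involutions of S⁴ preserve none), just as they carry no metric with
Rm > 0. Consistent, but a bet: an invariant CBB(1) polyhedral metric for an exotic involution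
refutes REC.
- Literature.Barriers.SmoothPoincare4.TwistedSphereBarrierFour: not invoked on the main spine (no
two-disc decomposition; Γ₄ = 0 unused); only the fallback Grove–Shiohama spine ends in a twisted
sphere and uses cerf_twistedSphere_four as an engine, not against the barrier.
- Literature.Barriers.SmoothPoincare4.HCobordismBarrierFour: not invoked — no h-cobordism, handle or
cork argument anywhere.
- Literature.Barriers.SmoothPoincare4.GaugeSumBarrierFour: no invariant of the blind class is used;
"admits a certificate" is a one-sided existen

Novelty grade: variant — refuter route-review 2026-08-15: VARIANT. The mechanism 'polyhedral positive curvature (K>0 pieces, cone angles ≤2π) is a curvature-OPERATOR condition; smooth it and run Hamilton's PCO flow' is in print since 1986: Cheeger LNM 1201 Thm 3 (certified pseudomanifolds are real homology spheres — which a (refuter refuter-rreview-route-CriticalPhenomena--7f1b1fc9-0, 2026-08-15T14:02:33Z; prior: Cheeger1986 doi:10.1007/bfb0075646 Thm 3(ii) + Remark 6 (Gromov/Hamilton PCO suggestion), ChegerMullerSchrader1984 doi:10.1007/bf01210729 (angle defects = curvature of piecewise flat spaces), arXiv:1411.0307 (LMPS Smoothing Conjecture, dim 3 proved; printed for CBB(0)),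 Petrunin2003 (polyhedral approximations: necessity, cosectional), Peszek1992 doi:10.2307/2153984 (nonnegative curvature on p.c.c.)

History (route lifecycle, newest last):
- 2026-08-15T16:55:14Z · rev 4: restated CertifiedSpheresExist (stmt-SmoothPoincare4-7223), Assembly (stmt-SmoothPoincare4-7228) — route-repair (cone, rrepair-64ce85cb): RE-ROUTED AROUND the route's only unproved used-constants dep (Literature.Geometry.Riemannian.hamilton_positiveCurvatureO (planner-rrepair-SmoothPoincare4-AngleDefectCer-64ce85cb-0)
- 2026-08-15T16:55:14Z · rev 4: dropped HamiltonPcoClassification — route-repair (cone, rrepair-64ce85cb): RE-ROUTED AROUND the route's only unproved used-constants dep (Literature.Geometry.Riemannian.hamilton_positiveCurvatureO (planner-rrepair-SmoothPoincare4-AngleDefectCer-64ce85cb-0)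
- 2026-08-15T17:32:50Z · rev 6: restated CertificateKillsSecondHomology (stmt-SmoothPoincare4-7226) — @note.txt (planner-rrepair-SmoothPoincare4-AngleDefectCer-64ce85cb-g2-0)
- 2026-08-16T04:17:37Z · AUTO-CRUX (backfill): CertifiedSpheresExist — hypotheses of the deciding theorem that nothing in the route derives are cruxes (operator:999:1085951)
- 2026-08-23T00:30:40Z · DORMANT — reconciler: no traction for 5.8 d (last activity item-evidence-added at 2026-08-17T04:56:18Z); parked, not closed — `ledger route dormant route-SmoothPoincare4- (operator:999:2316814)

sub-problem: SmoothPoincare4 · status: dormant · opened planner-plancard-SmoothPoincare4-SmoothPoinca-4a18913f-0 2026-08-15T12:05:34Z · rev 7 · ledger route-SmoothPoincare4-AngleDefectCertificates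
GENERATED by the gate from the ledger (D-0016/17). Provers cite these decls: `theorem foo : Summit.SmoothPoincare4.SmoothPoincare4.Theses.AngleDefectCertificates.<Decl> := …` in Summits/SmoothPoincare4/SmoothPoincare4/Theorems/<Name>.lean.
-/

namespace Summit.SmoothPoincare4.SmoothPoincare4.Theses.AngleDefectCertificates

open scoped BigOperators Topology Manifold Classical MeasureTheory ProbabilityTheory Matrix InnerProductSpace ComplexConjugate ContinuousMap ContDiff
open Filter Set Function TopologicalSpace MeasureTheory

attribute [summit_statement] _root_.SmoothPoincare4

open Literature.SPC4

-- earlier CertifiedSpheresExist (stmt-SmoothPoincare4-7223, replaced 2026-08-15T16:55:14Z -> stmt-SmoothPoincare4-11223): retired by None — ∀ S : Literature.Topology.FourManifolds.HomotopySphere 4, (∃ (N : ℕ) (K : Geometry.SimplicialComplex ℝ (EuclideanSpace ℝ (Fin N))) (h : K.space ≃ₜ S.carrier) (c : EuclideanSpace ℝ (Fin N) → EuclideanSpace ℝ (Fin N) → ℝ), K.faces.Finite ∧ (∀ s ∈ K.faces, ∃ σ ∈ K.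
/-- item stmt-SmoothPoincare4-11223 · crux (kind.auto-crux: conjecture-grade) · rank 0 · open · by planner
why it might fail: ⇔ SPC4 given REC_sc; constructively, admissible spherical lengths may exist on NO triangulation the engine reaches from a presentation-sphere triangulation (dihedral-angle sums of a 4-simplex are bounded below, so high triangle valence obstructs), so nothing new is ever certified.
sources: TsurugaLutz2013, arXiv:1302.6856, BuragoGromovPerelman1992, AlexanderKapovitchPetrunin2024, Whitehead1940
[target] EX over the Statement's own quantifier shape (rev 4): every Hausdorff second-countable
smooth 4-manifold M (C^∞ on ℝ⁴) homotopy equivalent to S⁴ admits an angle-defect certificate: a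
finite simplicial complex K ⊂ ℝᴺ, pure of dimension 4, a homeomorphism |K| ≃ₜ M that is a smooth
immersion on each closed simplex, and a symmetric unit-diagonal cosine function c with every 4-face
Gram matrix positive definite and every triangle's spherical dihedral-angle sum ≤ 2π (card items
VOL/certificate, without the volume threshold). Same content as revs 0–3 (there over `HomotopySphere
4`: compactness and orientability follow from M ≃ₕ S⁴ by the proved
compactSpace_/isOrientable_of_homotopyEquiv_sphere_four) — unbundled so that the route no longer
imports HomotopySpheres/Cobordism and `closes` needs no packaging. [difficulty: open-problem (⇔ SPC4
given REC_sc)] -/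
@[route_item "route-SmoothPoincare4-AngleDefectCertificates", crux]
def CertifiedSpheresExist : Prop :=
  ∀ (M : Type) [TopologicalSpace M] [T2Space M] [SecondCountableTopology M] [ChartedSpace (EuclideanSpace ℝ (Fin 4)) M] [IsManifold (𝓡 4) ∞ M], M ≃ₕ Metric.sphere (0 : EuclideanSpace ℝ (Fin 5)) 1 → (∃ (N : ℕ) (K : Geometry.SimplicialComplex ℝ (EuclideanSpace ℝ (Fin N))) (h : K.space ≃ₜ M) (c : EuclideanSpace ℝ (Fin N) → EuclideanSpace ℝ (Fin N) → ℝ), K.faces.Finite ∧ (∀ s ∈ K.faces, ∃ σ ∈ K.faces, s ⊆ σ ∧ σ.card = 5) ∧ (∀ s ∈ K.faces, ∃ (g : EuclideanSpace ℝ (Fin N) → M) (u : Set (EuclideanSpace ℝ (Fin N))), IsOpen u ∧ convexHull ℝ (s : Set (EuclideanSpace ℝ (Fin N))) ⊆ u ∧ ContMDiffOn 𝓘(ℝ, EuclideanSpace ℝ (Fin N)) (𝓡 4) ∞ g u ∧ (∀ y : K.space, (y : EuclideanSpace ℝ (Fin N)) ∈ convexHull ℝ (s : Set (EuclideanSpace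 ℝ (Fin N))) → h y = g y) ∧ ∀ x ∈ convexHull ℝ (s : Set (EuclideanSpace ℝ (Fin N))), Set.InjOn (mfderiv 𝓘(ℝ, EuclideanSpace ℝ (Fin N)) (𝓡 4) g x) (vectorSpan ℝ (s : Set (EuclideanSpace ℝ (Fin N))) : Set (EuclideanSpace ℝ (Fin N)))) ∧ (∀ a b, c a b = c b a) ∧ (∀ a, c a a = 1) ∧ (∀ σ ∈ K.faces, σ.card = 5 → (Matrix.of fun a b : σ => c a b).PosDef) ∧ (∀ t ∈ K.faces, t.card = 3 → ∑ᶠ σ ∈ {σ : Finset (EuclideanSpace ℝ (Fin N)) | σ ∈ K.faces ∧ t ⊆ σ ∧ σ.card = 5}, (∑ a : σ, ∑ b : σ, if (a : EuclideanSpace ℝ (Fin N)) ∉ t ∧ (b : EuclideanSpace ℝ (Fin N)) ∉ t ∧ a ≠ b then Real.arccos (-((Matrix.of fun a b : σ => c a b)⁻¹ a b / Real.sqrt ((Matrix.of fun a b : σ => c a b)⁻¹ a a * (Matrix.of fun a b : σ => c a b)⁻¹ b b))) / 2 else 0) ≤ 2 * Real.pi))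

/-- item stmt-SmoothPoincare4-11225 · crux · rank 2 · open · by planner
why it might fail: Folds Petrunin's dim-4 smoothing conjecture AND Hamilton 1986 into one claim: ONE certificate on a simply connected closed 4-manifold ≠ S⁴ kills it — ℂP², S²×S² (b₂ ≠ 0; ℂP²₉/S²×S²₁₁ searches empty, fruitless by Cheeger1986) or a certified exotic homotopy sphere; no convex model at dim-4 vertices.
sources: ShevchishinEtAl2015, arXiv:1411.0307, Petrunin2003, BamlerCabezasrivasWilking2019, arXiv:1707.03002, Hamilton1986
[crux] REC_sc, recognition form (rev 4, the deciding-chain item) — a Hausdorff second-countable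
SIMPLY CONNECTED smooth 4-manifold (C^∞ on ℝ⁴) carrying an angle-defect certificate for its own
smooth structure (finite simplicial complex K ⊂ ℝᴺ pure of dimension 4, |K| ≃ₜ M a smooth immersion
on each closed simplex, symmetric unit-diagonal cosines, every 4-face Gram matrix positive definite,
every triangle's spherical dihedral-angle sum ≤ 2π; M is then closed) is diffeomorphic to S⁴.
Intended proof = the line's whole smooth half: certificate ⇒ C^∞ metric of positive curvature
operator on the same structure (support PolyhedralPCORecognition = Petrunin's Smoothing Conjecture,
dim 4, PL, κ = 1) ⇒ Hamilton 1986 Thm 1.1 + Killing–Hopf (Literature debt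
`Literature.Geometry.Riemannian.hamilton_positiveCurvatureOperator_classification_four`, reduced in
tree to H1 + H2 with the tail proved, HamiltonPCOClassificationProofs.lean; needs-fact, not a
hypothesis) ⇒ S⁴ for π₁ = 1. Recognition form as in RicciFat.VolumeSphereRecognition /
EntropyRung.SubcylindricalRecognition, so that `closes` rests on items and proved facts only; it
does not contain Hamilton's theorem (PCO metrics are not known to a -/
@[route_item "route-SmoothPoincare4-AngleDefectCertificates", crux]
def PolyhedralSphereRecognition : Prop :=
  ∀ (M : Type) [TopologicalSpace M] [T2Space M] [SecondCountableTopology M] [ChartedSpace (EuclideanSpace ℝ (Fin 4)) M] [IsManifold (𝓡 4) ∞ M] [SimplyConnectedSpace M], (∃ (N : ℕ) (K : Geometry.SimplicialComplex ℝ (EuclideanSpace ℝ (Fin N))) (h : K.space ≃ₜ M) (c : EuclideanSpace ℝ (Fin N) → EuclideanSpace ℝ (Fin N) → ℝ), K.faces.Finite ∧ (∀ s ∈ K.faces, ∃ σ ∈ K.faces, s ⊆ σ ∧ σ.card = 5) ∧ (∀ s ∈ K.faces, ∃ (g : EuclideanSpace ℝ (Fin N) → M) (u : Set (EuclideanSpace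 ℝ (Fin N))), IsOpen u ∧ convexHull ℝ (s : Set (EuclideanSpace ℝ (Fin N))) ⊆ u ∧ ContMDiffOn 𝓘(ℝ, EuclideanSpace ℝ (Fin N)) (𝓡 4) ∞ g u ∧ (∀ y : K.space, (y : EuclideanSpace ℝ (Fin N)) ∈ convexHull ℝ (s : Set (EuclideanSpace ℝ (Fin N))) → h y = g y) ∧ ∀ x ∈ convexHull ℝ (s : Set (EuclideanSpace ℝ (Fin N))), Set.InjOn (mfderiv 𝓘(ℝ, EuclideanSpace ℝ (Fin N)) (𝓡 4) g x) (vectorSpan ℝ (s : Set (EuclideanSpace ℝ (Fin N))) : Set (EuclideanSpace ℝ (Fin N)))) ∧ (∀ a b, c a b = c b a) ∧ (∀ a, c a a = 1) ∧ (∀ σ ∈ K.faces, σ.card = 5 → (Matrix.of fun a b : σ => c a b).PosDef) ∧ (∀ t ∈ K.faces, t.card = 3 → ∑ᶠ σ ∈ {σ : Finset (EuclideanSpace ℝ (Fin N)) | σ ∈ K.faces ∧ t ⊆ σ ∧ σ.card = 5}, (∑ a : σ, ∑ b : σ, if (a : EuclideanSpace ℝ (Fin N)) ∉ t ∧ (b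 : EuclideanSpace ℝ (Fin N)) ∉ t ∧ a ≠ b then Real.arccos (-((Matrix.of fun a b : σ => c a b)⁻¹ a b / Real.sqrt ((Matrix.of fun a b : σ => c a b)⁻¹ a a * (Matrix.of fun a b : σ => c a b)⁻¹ b b))) / 2 else 0) ≤ 2 * Real.pi)) → Nonempty (M ≃ₘ⟮𝓡 4, 𝓡 4⟯ Metric.sphere (0 : EuclideanSpace ℝ (Fin 5)) 1)

/-- item stmt-SmoothPoincare4-7225 · crux · rank 3 · open · by planner
why it might fail: gluing the local convex smoothings at vertices/edges/triangles into metrics with curvature operator ≥ −ε, uniformly non-collapsed, is unproved beyond dim 3; BCRW Cor. 3 then yields Rm ≥ 0 only, and Rm > 0 needs Hamilton's strong maximum principle to exclude Kähler/product/flat alternatives.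
sources: ShevchishinEtAl2015, arXiv:1411.0307, BamlerCabezasrivasWilking2019, arXiv:1707.03002, Deruelle2016, GianniotisSchulze2018
[crux] REC restricted to LINK-POLYTOPAL certificates: additionally, for every vertex v the link of v
(neighbours a of v, spherical edge lengths = the angles at v, cosines by the spherical law of
cosines) is realised simplexwise-isometrically by unit vectors q(a) ∈ S⁴ ⊂ ℝ⁵ such that every link
tetrahedron spans a supporting hyperplane of all q(a) and distinct link tetrahedra have disjoint
open hulls — the link bounds a convex spherical 4-polytope, so every vertex star is a convex
hypersurface germ of S⁵ (curvature operator ≥ 1), exactly the local picture of the 3-dimensional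
LMPS proof. Conclusion as in REC. [difficulty: XL] -/
@[route_item "route-SmoothPoincare4-AngleDefectCertificates"]
def PolytopalPCORecognition : Prop :=
  ∀ (M : Type) [TopologicalSpace M] [T2Space M] [SecondCountableTopology M] [ChartedSpace (EuclideanSpace ℝ (Fin 4)) M] [IsManifold (𝓡 4) ∞ M], (∃ (N : ℕ) (K : Geometry.SimplicialComplex ℝ (EuclideanSpace ℝ (Fin N))) (h : K.space ≃ₜ M) (c : EuclideanSpace ℝ (Fin N) → EuclideanSpace ℝ (Fin N) → ℝ), K.faces.Finite ∧ (∀ s ∈ K.faces, ∃ σ ∈ K.faces, s ⊆ σ ∧ σ.card = 5) ∧ (∀ s ∈ K.faces, ∃ (g : EuclideanSpace ℝ (Fin N) → M) (u : Set (EuclideanSpace ℝ (Fin N))), IsOpen u ∧ convexHull ℝ (s : Set (EuclideanSpace ℝ (Fin N))) ⊆ u ∧ ContMDiffOn 𝓘(ℝ, EuclideanSpace ℝ (Fin N)) (𝓡 4) ∞ g u ∧ (∀ y : K.space, (y : EuclideanSpace ℝ (Fin N)) ∈ convexHull ℝ (s : Set (EuclideanSpace ℝ (Fin N))) → h y = g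 y) ∧ ∀ x ∈ convexHull ℝ (s : Set (EuclideanSpace ℝ (Fin N))), Set.InjOn (mfderiv 𝓘(ℝ, EuclideanSpace ℝ (Fin N)) (𝓡 4) g x) (vectorSpan ℝ (s : Set (EuclideanSpace ℝ (Fin N))) : Set (EuclideanSpace ℝ (Fin N)))) ∧ (∀ a b, c a b = c b a) ∧ (∀ a, c a a = 1) ∧ (∀ σ ∈ K.faces, σ.card = 5 → (Matrix.of fun a b : σ => c a b).PosDef) ∧ (∀ t ∈ K.faces, t.card = 3 → ∑ᶠ σ ∈ {σ : Finset (EuclideanSpace ℝ (Fin N)) | σ ∈ K.faces ∧ t ⊆ σ ∧ σ.card = 5}, (∑ a : σ, ∑ b : σ, if (a : EuclideanSpace ℝ (Fin N)) ∉ t ∧ (b : EuclideanSpace ℝ (Fin N)) ∉ t ∧ a ≠ b then Real.arccos (-((Matrix.of fun a b : σ => c a b)⁻¹ a b / Real.sqrt ((Matrix.of fun a b : σ => c a b)⁻¹ a a * (Matrix.of fun a b : σ => c a b)⁻¹ b b))) / 2 else 0) ≤ 2 * Real.pi) ∧ (∀ v : EuclideanSpace ℝ (Fin N), ({v} : Finset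 (EuclideanSpace ℝ (Fin N))) ∈ K.faces → ∃ q : EuclideanSpace ℝ (Fin N) → EuclideanSpace ℝ (Fin 5), (∀ a, ({v, a} : Finset (EuclideanSpace ℝ (Fin N))) ∈ K.faces → a ≠ v → ‖q a‖ = 1) ∧ (∀ a b, ({v, a, b} : Finset (EuclideanSpace ℝ (Fin N))) ∈ K.faces → a ≠ v → b ≠ v → a ≠ b → inner ℝ (q a) (q b) = (c a b - c v a * c v b) / (Real.sqrt (1 - c v a ^ 2) * Real.sqrt (1 - c v b ^ 2))) ∧ (∀ τ : Finset (EuclideanSpace ℝ (Fin N)), τ.card = 4 → v ∉ τ → insert v τ ∈ K.faces → ∃ n : EuclideanSpace ℝ (Fin 5), n ≠ 0 ∧ (∀ a ∈ τ, inner ℝ n (q a) = 0) ∧ ∀ f, ({v, f} : Finset (EuclideanSpace ℝ (Fin N))) ∈ K.faces → f ≠ v → 0 ≤ inner ℝ n (q f)) ∧ (∀ τ τ' : Finset (EuclideanSpace ℝ (Fin N)), τ.card = 4 → τ'.card = 4 → v ∉ τ → v ∉ τ' → insert v τ ∈ K.faces → insert v τ' ∈ K.faces → τ ≠ τ' → ∀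 α β : EuclideanSpace ℝ (Fin N) → ℝ, (∀ a ∈ τ, 0 < α a) → (∀ b ∈ τ', 0 < β b) → ∑ a ∈ τ, α a • q a ≠ ∑ b ∈ τ', β b • q b))) → ∃ g : Literature.Geometry.Lorentzian.PseudoRiemannianMetric (𝓡 4) ∞ (EuclideanSpace ℝ (Fin 4)) (TangentSpace (𝓡 4) : M → Type _), g.IsRiemannian ∧ g.HasPositiveCurvatureOperator

/-- item stmt-SmoothPoincare4-7224 · support · rank 2 · open · by planner
why it might fail: vertex links are arbitrary CBB(1) polyhedral 3-spheres, not convex-polytope boundaries (LMPS Cor. 6 fails in dim 4): no local convex model; cone tips need Rm(link) ≥ 1; ONE smooth-compatible CBB(1) polyhedral metric on ℂP² (ℂP²₉ is CBB(0) already, Panov2009 p.3), S²×S² or a fake ℝP⁴ kills it.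
sources: ShevchishinEtAl2015, arXiv:1411.0307, Petrunin2003, BamlerCabezasrivasWilking2019, arXiv:1707.03002, GianniotisSchulze2018
[crux] REC — a Hausdorff second-countable smooth 4-manifold carrying an angle-defect certificate (as
in the target, for its own smooth structure; it is then closed) admits a C^∞ Riemannian metric with
positive curvature operator. Petrunin's Smoothing Conjecture in dimension 4 for PL manifolds,
spherical (κ = 1) case, with the smoothing on the SAME smooth structure (card crux SMOOTH₄, PCO
form). [difficulty: open-problem] -/
@[route_item "route-SmoothPoincare4-AngleDefectCertificates"]
def PolyhedralPCORecognition : Prop :=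
  ∀ (M : Type) [TopologicalSpace M] [T2Space M] [SecondCountableTopology M] [ChartedSpace (EuclideanSpace ℝ (Fin 4)) M] [IsManifold (𝓡 4) ∞ M], (∃ (N : ℕ) (K : Geometry.SimplicialComplex ℝ (EuclideanSpace ℝ (Fin N))) (h : K.space ≃ₜ M) (c : EuclideanSpace ℝ (Fin N) → EuclideanSpace ℝ (Fin N) → ℝ), K.faces.Finite ∧ (∀ s ∈ K.faces, ∃ σ ∈ K.faces, s ⊆ σ ∧ σ.card = 5) ∧ (∀ s ∈ K.faces, ∃ (g : EuclideanSpace ℝ (Fin N) → M) (u : Set (EuclideanSpace ℝ (Fin N))), IsOpen u ∧ convexHull ℝ (s : Set (EuclideanSpace ℝ (Fin N))) ⊆ u ∧ ContMDiffOn 𝓘(ℝ, EuclideanSpace ℝ (Fin N)) (𝓡 4) ∞ g u ∧ (∀ y : K.space, (y : EuclideanSpace ℝ (Fin N)) ∈ convexHull ℝ (s : Set (EuclideanSpace ℝ (Fin N))) → h y = g y) ∧ ∀ x ∈ convexHull ℝ (s : Set (EuclideanSpace ℝ (Fin N))), Set.InjOn (mfderiv 𝓘(ℝ, EuclideanSpace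 ℝ (Fin N)) (𝓡 4) g x) (vectorSpan ℝ (s : Set (EuclideanSpace ℝ (Fin N))) : Set (EuclideanSpace ℝ (Fin N)))) ∧ (∀ a b, c a b = c b a) ∧ (∀ a, c a a = 1) ∧ (∀ σ ∈ K.faces, σ.card = 5 → (Matrix.of fun a b : σ => c a b).PosDef) ∧ (∀ t ∈ K.faces, t.card = 3 → ∑ᶠ σ ∈ {σ : Finset (EuclideanSpace ℝ (Fin N)) | σ ∈ K.faces ∧ t ⊆ σ ∧ σ.card = 5}, (∑ a : σ, ∑ b : σ, if (a : EuclideanSpace ℝ (Fin N)) ∉ t ∧ (b : EuclideanSpace ℝ (Fin N)) ∉ t ∧ a ≠ b then Real.arccos (-((Matrix.of fun a b : σ => c a b)⁻¹ a b / Real.sqrt ((Matrix.of fun a b : σ => c a b)⁻¹ a a * (Matrix.of fun a b : σ => c a b)⁻¹ b b))) / 2 else 0) ≤ 2 * Real.pi)) → ∃ g : Literature.Geometry.Lorentzian.PseudoRiemannianMetric (𝓡 4) ∞ (EuclideanSpace ℝ (Fin 4)) (TangentSpace (𝓡 4) : M → Type _), g.IsRiemannian ∧ g.HasPositiveCurv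atureOperator

-- earlier CertificateKillsSecondHomology (stmt-SmoothPoincare4-7226, replaced 2026-08-15T17:32:50Z -> stmt-SmoothPoincare4-11383): retired by None — ∀ (M : Type) [TopologicalSpace M] [T2Space M] [SecondCountableTopology M] [ChartedSpace (EuclideanSpace ℝ (Fin 4)) M] [IsManifold (𝓡 4) ∞ M] [SimplyConnectedSpace M], (∃ (N : ℕ) (K : Geometry.SimplicialComplex ℝ (EuclideanSpace ℝ (Fin N))) (h : K.space 
/-- item stmt-SmoothPoincare4-11383 · support · rank 4 · open · by planner
why it might fail: Cheeger's L²-Hodge vanishing argument is printed for piecewise FLAT spaces with ideal boundary conditions at strata; with spherical pieces the codim-3/4 strata must contribute signed terms; false outright if ℂP²₉ or a triangulated S²×S² admits admissible lengths (searches so far: none).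
sources: Cheeger1986, doi:10.1007/bfb0075646, Cheeger1983, Panov2009, HatcherAT2002
[support] polyhedral Bochner — a closed SIMPLY CONNECTED smooth 4-manifold with an angle-defect
certificate has H₂(M; ℤ) = 0 (so ℂP², S²×S², #ₙℂP² carry no smooth-compatible CBB(1) polyhedral
metric). KNOWN in print: Cheeger1986 (LNM 1201) Thm 3(ii) — a closed piecewise-constant-curvature
space with curvature ≥ 0 in Cheeger's sense (here: spherical simplices, cone angles ≤ 2π at
triangles) is a real homology sphere or has parallel harmonic forms; with K ≡ 1 pieces the
Weitzenböck constant term is strictly positive, so harmonic 2-forms vanish (Cheeger1983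
piecewise-flat case; Panov2009 p.3 for the CBB(0) ℂPⁿ). Also a consequence of REC (Rm > 0 kills
harmonic 2-forms). The line's falsifiable prediction; cheapest falsifier EXECUTED (refuters g41-12,
g41-43 on stmt-SmoothPoincare4-7226: certificate searches on Kühnel–Banchoff ℂP²₉ and Lutz S²×S²₁₁
found none, min-max cone excess > 0 at every scale). Rev 5 (cone repair g2): conclusion written over
Mathlib's `AlgebraicTopology.singularHomologyFunctor (ModuleCat ℤ) 2` at coefficients `ULift ℤ`,
i.e. the literal unfolding of `Literature.Topology.FourManifolds.singularHomologyZ M 2` —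
DEFINITIONALLY EQUAL to stmt-SmoothPoincare4-7226 (`Iff. -/
@[route_item "route-SmoothPoincare4-AngleDefectCertificates"]
def CertificateKillsSecondHomology : Prop :=
  ∀ (M : Type) [TopologicalSpace M] [T2Space M] [SecondCountableTopology M] [ChartedSpace (EuclideanSpace ℝ (Fin 4)) M] [IsManifold (𝓡 4) ∞ M] [SimplyConnectedSpace M], (∃ (N : ℕ) (K : Geometry.SimplicialComplex ℝ (EuclideanSpace ℝ (Fin N))) (h : K.space ≃ₜ M) (c : EuclideanSpace ℝ (Fin N) → EuclideanSpace ℝ (Fin N) → ℝ), K.faces.Finite ∧ (∀ s ∈ K.faces, ∃ σ ∈ K.faces, s ⊆ σ ∧ σ.card = 5) ∧ (∀ s ∈ K.faces, ∃ (g : EuclideanSpace ℝ (Fin N) → M) (u : Set (EuclideanSpace ℝ (Fin N))), IsOpen u ∧ convexHull ℝ (s : Set (EuclideanSpace ℝ (Fin N))) ⊆ u ∧ ContMDiffOn 𝓘(ℝ, EuclideanSpace ℝ (Fin N)) (𝓡 4) ∞ g u ∧ (∀ y : K.space, (y : EuclideanSpace ℝ (Fin N)) ∈ convexHull ℝ (s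 : Set (EuclideanSpace ℝ (Fin N))) → h y = g y) ∧ ∀ x ∈ convexHull ℝ (s : Set (EuclideanSpace ℝ (Fin N))), Set.InjOn (mfderiv 𝓘(ℝ, EuclideanSpace ℝ (Fin N)) (𝓡 4) g x) (vectorSpan ℝ (s : Set (EuclideanSpace ℝ (Fin N))) : Set (EuclideanSpace ℝ (Fin N)))) ∧ (∀ a b, c a b = c b a) ∧ (∀ a, c a a = 1) ∧ (∀ σ ∈ K.faces, σ.card = 5 → (Matrix.of fun a b : σ => c a b).PosDef) ∧ (∀ t ∈ K.faces, t.card = 3 → ∑ᶠ σ ∈ {σ : Finset (EuclideanSpace ℝ (Fin N)) | σ ∈ K.faces ∧ t ⊆ σ ∧ σ.card = 5}, (∑ a : σ, ∑ b : σ, if (a : EuclideanSpace ℝ (Fin N)) ∉ t ∧ (b : EuclideanSpace ℝ (Fin N)) ∉ t ∧ a ≠ b then Real.arccos (-((Matrix.of fun a b : σ => c a b)⁻¹ a b / Real.sqrt ((Matrix.of fun a b : σ => c a b)⁻¹ a a * (Matrix.of fun a b : σ => c a b)⁻¹ b b))) / 2 else 0) ≤ 2 * Real.pi)) → CategoryTheory.Limits.IsZero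 (((AlgebraicTopology.singularHomologyFunctor (ModuleCat.{0} ℤ) 2).obj (ModuleCat.of ℤ (ULift.{0} ℤ))).obj (TopCat.of M))

/-- item stmt-SmoothPoincare4-7227 · support · rank 9 · open · by planner
sources: Whitehead1940, Munkres1966, KuhnelBanchoff1983
[support] calibration and non-vacuity — the standard S⁴ ⊂ ℝ⁵ (Mathlib's smooth structure) admits an
angle-defect certificate: radially project the boundary of the regular 5-simplex inscribed in S⁴ (6
vertices, c ≡ −1/5, dihedral angles 2π/3, three 4-simplices around each triangle, cone angles
exactly 2π), or any smaller copy c ≡ cos((1−s)·arccos(−1/5)); the smooth-immersion clause is the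
smoothness of central projection on each affine simplex. [difficulty: M] -/
@[route_item "route-SmoothPoincare4-AngleDefectCertificates"]
def RoundSphereCertificate : Prop :=
  ∃ (N : ℕ) (K : Geometry.SimplicialComplex ℝ (EuclideanSpace ℝ (Fin N))) (h : K.space ≃ₜ (Metric.sphere (0 : EuclideanSpace ℝ (Fin 5)) 1)) (c : EuclideanSpace ℝ (Fin N) → EuclideanSpace ℝ (Fin N) → ℝ), K.faces.Finite ∧ (∀ s ∈ K.faces, ∃ σ ∈ K.faces, s ⊆ σ ∧ σ.card = 5) ∧ (∀ s ∈ K.faces, ∃ (g : EuclideanSpace ℝ (Fin N) → (Metric.sphere (0 : EuclideanSpace ℝ (Fin 5)) 1)) (u : Set (EuclideanSpace ℝ (Fin N))), IsOpen u ∧ convexHull ℝ (s : Set (EuclideanSpace ℝ (Fin N))) ⊆ u ∧ ContMDiffOn 𝓘(ℝ, EuclideanSpace ℝ (Fin N)) (𝓡 4) ∞ g u ∧ (∀ y : K.space, (y : EuclideanSpace ℝ (Fin N)) ∈ convexHull ℝ (s : Set (EuclideanSpace ℝ (Fin N))) → h y = g y) ∧ ∀ x ∈ convexHull ℝ (s :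 Set (EuclideanSpace ℝ (Fin N))), Set.InjOn (mfderiv 𝓘(ℝ, EuclideanSpace ℝ (Fin N)) (𝓡 4) g x) (vectorSpan ℝ (s : Set (EuclideanSpace ℝ (Fin N))) : Set (EuclideanSpace ℝ (Fin N)))) ∧ (∀ a b, c a b = c b a) ∧ (∀ a, c a a = 1) ∧ (∀ σ ∈ K.faces, σ.card = 5 → (Matrix.of fun a b : σ => c a b).PosDef) ∧ (∀ t ∈ K.faces, t.card = 3 → ∑ᶠ σ ∈ {σ : Finset (EuclideanSpace ℝ (Fin N)) | σ ∈ K.faces ∧ t ⊆ σ ∧ σ.card = 5}, (∑ a : σ, ∑ b : σ, if (a : EuclideanSpace ℝ (Fin N)) ∉ t ∧ (b : EuclideanSpace ℝ (Fin N)) ∉ t ∧ a ≠ b then Real.arccos (-((Matrix.of fun a b : σ => c a b)⁻¹ a b / Real.sqrt ((Matrix.of fun a b : σ => c a b)⁻¹ a a * (Matrix.of fun a b : σ => c a b)⁻¹ b b))) / 2 else 0) ≤ 2 * Real.pi)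

-- earlier Assembly (stmt-SmoothPoincare4-7228, replaced 2026-08-15T16:55:14Z -> stmt-SmoothPoincare4-11224): retired by None — HamiltonPcoClassification → PolyhedralPCORecognition → CertifiedSpheresExist → _root_.SmoothPoincare4
/-- item stmt-SmoothPoincare4-11224 · assembly · rank 1 · open · by planner
sources: HatcherAT2002, LeeSmoothManifolds2013
[assembly] PolyhedralSphereRecognition → CertifiedSpheresExist → SmoothPoincare4 (rev 4): pure logic
plus π₁(S⁴) = 1 (simplyConnectedSpace_sphere_four_holds, proved) transported along the homotopy
equivalence (Mathlib ContinuousMap.HomotopyEquiv.simplyConnectedSpace); literally the deciding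
theorem `closes`, provable now (`assembly_holds := fun hRec hEx => closes hRec hEx`, planner
Sketch.lean rc 0). -/
@[route_item "route-SmoothPoincare4-AngleDefectCertificates"]
def Assembly : Prop :=
  PolyhedralSphereRecognition → CertifiedSpheresExist → _root_.SmoothPoincare4

/-! D-0027 §2.1 — DECIDING THEOREM (planner-authored via `route open/edit --closes-file`; by planner-rrepair-SmoothPoincare4-AngleDefectCer-64ce85cb-0 2026-08-15T16:55:14Z):
its hypotheses are this route's items and its conclusion the sub-problem Statement (glue_lint), and it elaborates with this file. -/

@[closes "route-SmoothPoincare4-AngleDefectCertificates"] theorem closes (hRec : PolyhedralSphereRecognition) (hEx : CertifiedSpheresExist) :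
    _root_.SmoothPoincare4 := by
  -- SmoothPoincare4 unfolds to: ∀ M (Hausdorff, 2nd countable) [C^∞ atlas on ℝ⁴], M ≃ₕ S⁴ → Nonempty (M ≃ₘ S⁴).
  intro M _ _ _ _ _ e
  -- π₁(S⁴) = 1 (proved in tree, Hatcher Prop. 1.14), transported along the homotopy equivalence (Mathlib)
  haveI : SimplyConnectedSpace (Metric.sphere (0 : EuclideanSpace ℝ (Fin 5)) 1) :=
    Literature.Topology.FourManifolds.simplyConnectedSpace_sphere_four_holds
  haveI : SimplyConnectedSpace M := e.simplyConnectedSpace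
  -- EX gives a certificate on M; REC_sc (recognition form) returns M ≃ₘ S⁴.
  exact hRec M (hEx M e)

end Summit.SmoothPoincare4.SmoothPoincare4.Theses.AngleDefectCertificates
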